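import Summits.NavierStokesRegularity.NavierStokesRegularity.Theorems.TypeILiouvilleTypeIliouvilleLWeakL3VanishingTail
import HarnessLib

/-!
# `Lᵖ` slices (`p ≤ 3`) have vanishing weak-`L³` lower tail (crux `TypeIliouvilleL`,
# stmt-NavierStokesRegularity-10661, persistent stub S3ᵐ): the weak-`L³` recurrence theorem with
# ONE Lebesgue slice

Helper file (theorems only, no definition, no named fact, no `sorry`; lands
`--supports stmt-NavierStokesRegularity-10661`). Feeds `…WeakL3VanishingTail`
(`oseenMild_const_of_backward_weakL3_const_of_tail`: weak-`L³` recurrence of `v(τ_k) − b` plus ONE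
slice with `s³·vol{s < |v(τ_{k₀}) − b|} → 0` forces `v ≡ b`) with the two Lebesgue sources of a
vanishing lower tail:

* `tendsto_cube_mul_meas_lt_of_memLp_three` — `g ∈ L³ ⇒ s³·vol{s < |g|} → 0` as `s → 0⁺`
  (dominated convergence: `s³𝟙_{s<|g|} ≤ |g|³`, `→ 0` pointwise);
* `tendsto_cube_mul_meas_lt_of_memLp_lt_three` — `g ∈ Lᵖ`, `0 < p < 3` ⇒ the same
  (Chebyshev: `s³·vol{s < |g|} ≤ s^{3−p}‖g‖ₚᵖ`);
* `oseenMild_const_of_backward_weakL3_const_of_memLp_slice` — a mild bounded ancient solution with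
  a uniform weak-`L³` bound of `v(τ_k) − b` along `τ_k → −∞` and ONE slice `v(τ_{k₀}) − b ∈ Lᵖ`,
  `0 < p ≤ 3`, is the constant `b` on the whole slab.  Compared with
  `…PersistentLpRecurrence` (recurrence IN `Lᵖ`, `p ≤ 3`, along the whole sequence) only ONE
  slice is asked to be Lebesgue, the sequence being merely weak-`L³` (the class containing the
  `O(|x|⁻¹)` wakes).

Nothing here proves S3ᵐ, (L), or anything about Navier–Stokes regularity.
-/

set_option linter.dupNamespace false

namespace Summit.NavierStokesRegularity.NavierStokesRegularity.Theorems

open MeasureTheory Filter Set Function Metric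
open scoped ENNReal NNReal Topology RealInnerProductSpace
open Literature.Analysis Literature.Analysis.FluidPDE

/-- **An `L³` function has vanishing weak-`L³` lower tail**: if `g ∈ L³(ℝ³)` then
`s³ · vol{x : s < ‖g x‖} → 0` as `s → 0⁺` (dominated convergence for `s³ 𝟙_{s < ‖g‖} ≤ ‖g‖³`,
which tends to `0` pointwise). [cite: Grafakos2014, Prop. 1.1.6 and Ex. 1.1.12 (L^p vs weak L^p)] -/
theorem tendsto_cube_mul_meas_lt_of_memLp_three {F : Type*} [NormedAddCommGroup F]
    {g : EuclideanSpace ℝ (Fin 3) → F} (hg : MemLp g 3 volume) :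
    Tendsto (fun s : ℝ => ENNReal.ofReal s ^ 3 *
        (volume : Measure (EuclideanSpace ℝ (Fin 3))) {x | s < ‖g x‖}) (𝓝[>] 0) (𝓝 0) := by
  have hgm : AEMeasurable (fun x => ‖g x‖) volume := hg.1.norm.aemeasurable
  -- the integrands `F s = s³ 𝟙_{s < ‖g‖}`
  set Fs : ℝ → EuclideanSpace ℝ (Fin 3) → ℝ≥0∞ :=
    fun s x => (Ioi s).indicator (fun _ : ℝ => (ENNReal.ofReal s ^ 3 : ℝ≥0∞)) ‖g x‖ with hFs
  have hFs_eq : ∀ s : ℝ, ∫⁻ x, Fs s x =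
      ENNReal.ofReal s ^ 3 * (volume : Measure (EuclideanSpace ℝ (Fin 3))) {x | s < ‖g x‖} := by
    intro s
    have hset : NullMeasurableSet {x : EuclideanSpace ℝ (Fin 3) | s < ‖g x‖} volume :=
      nullMeasurableSet_lt aemeasurable_const hgm
    rw [← lintegral_indicator_const₀ hset]
    rfl
  have hmeas : ∀ s : ℝ, AEMeasurable (Fs s) volume := fun s => by
    have h1 : Measurable
        (fun r : ℝ => (Ioi s).indicator (fun _ : ℝ => (ENNReal.ofReal s ^ 3 : ℝ≥0∞)) r) :=
      measurable_const.indicator measurableSet_Ioi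
    exact h1.comp_aemeasurable hgm
  -- domination by `‖g‖³`
  have hbound : ∀ s : ℝ, 0 < s → ∀ x, Fs s x ≤ ‖g x‖ₑ ^ 3 := by
    intro s hs x
    simp only [hFs]
    by_cases hx : ‖g x‖ ∈ Ioi s
    · rw [indicator_of_mem hx, ← ofReal_norm]
      exact pow_le_pow_left' (ENNReal.ofReal_le_ofReal (le_of_lt hx)) 3
    · rw [indicator_of_notMem hx]; exact zero_le
  have hfin : ∫⁻ x, ‖g x‖ₑ ^ 3 ∂(volume : Measure (EuclideanSpace ℝ (Fin 3))) ≠ ∞ := by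
    have h := lintegral_rpow_enorm_lt_top_of_eLpNorm_lt_top (by norm_num : (3 : ℝ≥0∞) ≠ 0)
      (by norm_num : (3 : ℝ≥0∞) ≠ ∞) hg.2
    have h3 : ((3 : ℝ≥0∞).toReal) = ((3 : ℕ) : ℝ) := by norm_num
    simp_rw [h3, ENNReal.rpow_natCast] at h
    exact h.ne
  -- pointwise convergence `F s x → 0`
  have hlim : ∀ x, Tendsto (fun s => Fs s x) (𝓝[>] 0) (𝓝 0) := by
    intro x
    have hup : Tendsto (fun s : ℝ => ENNReal.ofReal s ^ 3) (𝓝[>] 0) (𝓝 0) := by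
      have h1 : Tendsto (fun s : ℝ => ENNReal.ofReal s ^ 3) (𝓝 0) (𝓝 (ENNReal.ofReal 0 ^ 3)) :=
        ((ENNReal.continuous_pow 3).tendsto _).comp (ENNReal.continuous_ofReal.tendsto 0)
      rw [ENNReal.ofReal_zero, zero_pow three_ne_zero] at h1
      exact h1.mono_left nhdsWithin_le_nhds
    refine tendsto_of_tendsto_of_tendsto_of_le_of_le tendsto_const_nhds hup (fun s => zero_le)
      fun s => ?_
    simp only [hFs]
    by_cases hx : ‖g x‖ ∈ Ioi s
    · rw [indicator_of_mem hx]
    · rw [indicator_of_notMem hx]; exact zero_le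
  have h := tendsto_lintegral_filter_of_dominated_convergence' (μ := volume)
    (l := 𝓝[>] (0 : ℝ)) (F := Fs) (f := fun _ => 0) (fun x => ‖g x‖ₑ ^ 3)
    (Eventually.of_forall hmeas)
    (eventually_nhdsWithin_of_forall fun s hs => Eventually.of_forall (hbound s hs)) hfin
    (Eventually.of_forall hlim)
  simp only [lintegral_zero] at h
  simpa only [hFs_eq] using h

/-- **An `Lᵖ` function, `0 < p < 3`, has vanishing weak-`L³` lower tail**: if `g ∈ Lᵖ(ℝ³)` then
`s³ · vol{x : s < ‖g x‖} ≤ s^{3−p} ‖g‖ₚᵖ → 0` as `s → 0⁺` (Chebyshev). [cite: Grafakos2014, Prop. 1.1.6 (Chebyshev)] -/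
theorem tendsto_cube_mul_meas_lt_of_memLp_lt_three {F : Type*} [NormedAddCommGroup F]
    {g : EuclideanSpace ℝ (Fin 3) → F} {p : ℝ≥0∞} (hp0 : p ≠ 0) (hp3 : p < 3)
    (hg : MemLp g p volume) :
    Tendsto (fun s : ℝ => ENNReal.ofReal s ^ 3 *
        (volume : Measure (EuclideanSpace ℝ (Fin 3))) {x | s < ‖g x‖}) (𝓝[>] 0) (𝓝 0) := by
  have hptop : p ≠ ∞ := (hp3.trans_le le_top).ne
  have hq : 0 < p.toReal := ENNReal.toReal_pos hp0 hptop
  have hq3 : p.toReal < 3 := by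
    have h := (ENNReal.toReal_lt_toReal hptop (by norm_num)).2 hp3
    simpa using h
  set N : ℝ≥0∞ := eLpNorm g p volume ^ p.toReal with hN
  have hNtop : N ≠ ∞ := (ENNReal.rpow_lt_top_of_nonneg hq.le hg.2.ne).ne
  -- Chebyshev: `s^p vol{s < ‖g‖} ≤ N`, hence `s³ vol ≤ s^{3-p} N`
  have hcheb : ∀ s : ℝ, 0 < s →
      ENNReal.ofReal s ^ 3 * (volume : Measure (EuclideanSpace ℝ (Fin 3))) {x | s < ‖g x‖} ≤
        ENNReal.ofReal (s ^ (3 - p.toReal)) * N := by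
    intro s hs
    have hsub : {x : EuclideanSpace ℝ (Fin 3) | s < ‖g x‖} ⊆ {x | ENNReal.ofReal s ≤ ‖g x‖ₑ} := by
      intro x hx
      simp only [mem_setOf_eq] at hx ⊢
      rw [← ofReal_norm]
      exact ENNReal.ofReal_le_ofReal hx.le
    have h1 := mul_meas_ge_le_pow_eLpNorm' volume hp0 hptop hg.1 (ENNReal.ofReal s)
    have hsplit : ENNReal.ofReal s ^ 3 =
        ENNReal.ofReal (s ^ (3 - p.toReal)) * ENNReal.ofReal s ^ p.toReal := by
      rw [← ENNReal.ofReal_rpow_of_pos hs,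
        ← ENNReal.rpow_add _ _ (ENNReal.ofReal_pos.2 hs).ne' ENNReal.ofReal_ne_top,
        show (3 - p.toReal) + p.toReal = ((3 : ℕ) : ℝ) by push_cast; ring, ENNReal.rpow_natCast]
    calc ENNReal.ofReal s ^ 3 * (volume : Measure (EuclideanSpace ℝ (Fin 3))) {x | s < ‖g x‖}
        ≤ ENNReal.ofReal s ^ 3 * volume {x | ENNReal.ofReal s ≤ ‖g x‖ₑ} := by
          gcongr
      _ = ENNReal.ofReal (s ^ (3 - p.toReal)) *
            (ENNReal.ofReal s ^ p.toReal * volume {x | ENNReal.ofReal s ≤ ‖g x‖ₑ}) := by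
          rw [hsplit, mul_assoc]
      _ ≤ ENNReal.ofReal (s ^ (3 - p.toReal)) * N := by gcongr
  -- `s^{3-p} N → 0`
  have hpow : Tendsto (fun s : ℝ => ENNReal.ofReal (s ^ (3 - p.toReal)) * N) (𝓝[>] 0) (𝓝 0) := by
    have h1 : Tendsto (fun s : ℝ => s ^ (3 - p.toReal)) (𝓝[>] 0) (𝓝 0) := by
      have hc := (Real.continuousAt_rpow_const 0 (3 - p.toReal) (Or.inr (by linarith))).tendsto
      rw [Real.zero_rpow (by linarith)] at hc
      exact hc.mono_left nhdsWithin_le_nhds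
    have h2 : Tendsto (fun s : ℝ => ENNReal.ofReal (s ^ (3 - p.toReal))) (𝓝[>] 0) (𝓝 0) := by
      have h := (ENNReal.continuous_ofReal.tendsto 0).comp h1
      rwa [ENNReal.ofReal_zero] at h
    have h3 := ENNReal.Tendsto.mul_const h2 (Or.inr hNtop)
    rwa [zero_mul] at h3
  refine tendsto_of_tendsto_of_tendsto_of_le_of_le' tendsto_const_nhds hpow
    (Eventually.of_forall fun s => zero_le) ?_
  exact eventually_nhdsWithin_of_forall fun s hs => hcheb s hs

/-- **Weak-`L³` recurrence with ONE Lebesgue slice kills a mild bounded ancient solution on the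
whole slab.** Let `v` be continuous and uniformly bounded on `(−∞,0) × ℝ³`, weakly divergence free
on every slice and Oseen-mild, with negative times `τ_k → −∞` and a finite `M` such that
`s³ · vol{x : s < ‖v(τ_k,x) − b‖} ≤ M` for all `s > 0` and all `k` (uniform weak-`L³` bound —
the class of the `O(|x|⁻¹)` wakes). If ONE slice `v(τ_{k₀}) − b` lies in `Lᵖ(ℝ³)` for some
`0 < p ≤ 3`, then `v(t,x) = b` for all `t < 0` and all `x`
(`oseenMild_const_of_backward_weakL3_const_of_tail` with the vanishing lower tail of `Lᵖ`
functions). [cite: AlbrittonBarker2019, Thm 4.1 (arXiv:1811.00502 §4 p. 9)] -/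
theorem oseenMild_const_of_backward_weakL3_const_of_memLp_slice
    (v : ℝ → EuclideanSpace ℝ (Fin 3) → EuclideanSpace ℝ (Fin 3)) (b : EuclideanSpace ℝ (Fin 3))
    (hvc : ContinuousOn (uncurry v) (Iio 0 ×ˢ univ))
    (hvK : ∃ K : ℝ, ∀ t < 0, ∀ x, ‖v t x‖ ≤ K)
    (hvd : ∀ t < 0, IsWeaklyDivFree (v t))
    (hvm : ∀ s t : ℝ, s < t → t < 0 → ∀ x,
      v t x = UnboundedOperators.heatExtension (v s) (t - s) x - oseenDuhamel 1 s v v t x)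
    {τ : ℕ → ℝ} {M : ℝ≥0∞} (hM : M < ∞) (hτ : Tendsto τ atTop atBot) (hτ0 : ∀ k, τ k < 0)
    (hwk : ∀ (k : ℕ) (s : ℝ), 0 < s →
      ENNReal.ofReal s ^ 3 *
        (volume : Measure (EuclideanSpace ℝ (Fin 3))) {x | s < ‖v (τ k) x - b‖} ≤ M)
    {k₀ : ℕ} {p : ℝ≥0∞} (hp0 : p ≠ 0) (hp3 : p ≤ 3)
    (hslice : MemLp (fun x => v (τ k₀) x - b) p volume) :
    ∀ t < 0, ∀ x, v t x = b := by
  have htail : Tendsto (fun s : ℝ => ENNReal.ofReal s ^ 3 *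
      (volume : Measure (EuclideanSpace ℝ (Fin 3))) {x | s < ‖v (τ k₀) x - b‖}) (𝓝[>] 0) (𝓝 0) := by
    rcases hp3.eq_or_lt with h3 | h3
    · subst h3
      exact tendsto_cube_mul_meas_lt_of_memLp_three hslice
    · exact tendsto_cube_mul_meas_lt_of_memLp_lt_three hp0 h3 hslice
  exact oseenMild_const_of_backward_weakL3_const_of_tail v b hvc hvK hvd hvm hM hτ hτ0 hwk htail

end Summit.NavierStokesRegularity.NavierStokesRegularity.Theorems
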